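/-
Copyright (c) 2026. All rights reserved.
Released under Apache 2.0 license as described in the file LICENSE.
Authors: HodgeCM publication cell (pub-hodgecm), model-construction sub-cell, construction prover `mc-weil-1`.
-/
import Literature.RepresentationTheory.HeisenbergGroup.SchrodingerSymplecticGenerators

/-!
# Rank one: `Sp(W) = SL₂(F)` is generated by the Levi, unipotent and Weyl elements; (R1) is a theorem in rank one

Topic `RepresentationTheory/HeisenbergGroup`; namespace `Literature.RepresentationTheory.HeisenbergGroup`.

KERNEL throughout; no records. For a field `F` (with `2` invertible, as everywhere in this directory) and
`W = F × F` with `B = polar (LinearMap.mul F F)` (so `Sp(W) = SL₂(F)` acting on columns `(x, y)`):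
* §1 the rank-one generators `leviSp₁ t : (x,y) ↦ (t x, t⁻¹ y)` (`t ∈ Fˣ`), `unipSp₁ s : (x,y) ↦ (x, y + s x)`,
  `weylSp₁ : (x,y) ↦ (y, -x)` and the conjugate `upperSp₁ s = w · n(-s) · w⁻¹ : (x,y) ↦ (x + s y, y)`; the matrix
  entries `entryA … entryD` of `g ∈ Sp(W)` with `apply_eq_entries` and `det_entries : a d - b c = 1`;
* §2 **Bruhat decomposition in rank one** (`eq_bruhat_of_entryC_ne_zero`: `c ≠ 0 ⇒ g = u(a/c)·m(-1/c)·w·u(d/c)`,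
  `eq_borel_of_entryC_eq_zero`: `c = 0 ⇒ g = m(a)·u(b/a)`) and **generation**
  `closure_rankOne_eq_top : Subgroup.closure (range leviSp₁ ∪ range unipSp₁ ∪ {weylSp₁}) = ⊤`;
* §3 over a non-archimedean local field with a self-dual Haar measure: **(R1) holds in rank one as a THEOREM**,
  `existsImplementer_schrodingerSB_rankOne : ExistsImplementer (schrodingerSB (LinearMap.mul F F) ψ …)` — every
  `g ∈ SL₂(F)` admits an `M ∈ GL(𝒮(F))` with MVW's (A) — from the three memberships of
  `SchrodingerSymplecticGenerators.lean` / `TateWeylPair.lean` and `existsImplementer_of_closure_eq_top`; hence the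
  surjectivity half of MVW II.1 (B) needs no citation in rank one (`MpPsi.proj_surjective`).
-/

set_option autoImplicit false

noncomputable section

namespace Literature.RepresentationTheory.HeisenbergGroup

open _root_.MeasureTheory
open Literature.NumberTheory.Automorphic

universe u

/-! ## §1 Rank-one generators and matrix entries -/

section RankOne

variable {F : Type u} [Field F]

/-- `t x · t⁻¹ y = x y`. [folklore] -/
theorem mul_smulOfUnit_smulOfUnit_inv (t : Fˣ) (x y : F) :
    LinearMap.mul F F (LinearEquiv.smulOfUnit t x) (LinearEquiv.smulOfUnit t⁻¹ y) = LinearMap.mul F F x y := by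
  show ((t : F) • x) * ((t⁻¹ : Fˣ) : F) • y = x * y
  rw [smul_eq_mul, smul_eq_mul, Units.val_inv_eq_inv_val]
  field_simp

/-- the rank-one Levi element `m(t) : (x,y) ↦ (t x, t⁻¹ y)`, `t ∈ Fˣ`. [cite: Weil1964, n° 6, p. 151] -/
def leviSp₁ (t : Fˣ) : symplecticGroup (polar (LinearMap.mul F F)) :=
  leviSp (LinearMap.mul F F) (LinearEquiv.smulOfUnit t) (LinearEquiv.smulOfUnit t⁻¹)
    (mul_smulOfUnit_smulOfUnit_inv t)

/-- action of `m(t)`. [cite: Weil1964, n° 6, p. 151] -/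
@[simp] theorem coe_leviSp₁_apply (t : Fˣ) (p : F × F) :
    ((leviSp₁ t : symplecticGroup (polar (LinearMap.mul F F))) : (F × F) ≃ₗ[F] (F × F)) p
      = ((t : F) * p.1, (t : F)⁻¹ * p.2) := by
  rw [leviSp₁, coe_leviSp_apply]
  show ((t : F) • p.1, ((t⁻¹ : Fˣ) : F) • p.2) = _
  rw [smul_eq_mul, smul_eq_mul, Units.val_inv_eq_inv_val]

/-- `x (s x') = x' (s x)`: every `s ∈ F` is a symmetric map `X → Y` in rank one. [folklore] -/
theorem mul_mulLeft_symm (s x x' : F) :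
    LinearMap.mul F F x (LinearMap.mulLeft F s x') = LinearMap.mul F F x' (LinearMap.mulLeft F s x) := by
  simp only [LinearMap.mul_apply', LinearMap.mulLeft_apply]; ring

variable [Invertible (2 : F)]

/-- the rank-one (lower) unipotent element `n(s) : (x,y) ↦ (x, y + s x)`. [cite: Weil1964, n° 6, p. 151] -/
def unipSp₁ (s : F) : symplecticGroup (polar (LinearMap.mul F F)) :=
  unipotentSp (LinearMap.mul F F) (LinearMap.mulLeft F s) (mul_mulLeft_symm s)

/-- action of `n(s)`. [cite: Weil1964, n° 6, p. 151] -/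
@[simp] theorem coe_unipSp₁_apply (s : F) (p : F × F) :
    ((unipSp₁ s : symplecticGroup (polar (LinearMap.mul F F))) : (F × F) ≃ₗ[F] (F × F)) p = (p.1, p.2 + s * p.1) := by
  rw [unipSp₁, coe_unipotentSp, unipotentσ_apply, LinearMap.mulLeft_apply]

omit [Invertible (2 : F)] in
/-- the rank-one Weyl element `w : (x,y) ↦ (y, -x)` (the linear part of `tateWeylElt`). [cite: Weil1964, n° 6, p. 151] -/
def weylSp₁ : symplecticGroup (polar (LinearMap.mul F F)) :=
  weylSp (LinearMap.mul F F) (LinearEquiv.refl F F) (LinearEquiv.neg F) mul_refl_neg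

omit [Invertible (2 : F)] in
/-- action of `w`. [cite: Weil1964, n° 6, p. 151] -/
@[simp] theorem coe_weylSp₁_apply (p : F × F) :
    ((weylSp₁ : symplecticGroup (polar (LinearMap.mul F F))) : (F × F) ≃ₗ[F] (F × F)) p = (p.2, -p.1) := rfl

omit [Invertible (2 : F)] in
/-- action of `w⁻¹ : (x,y) ↦ (-y, x)`. [cite: Weil1964, n° 6, p. 151] -/
@[simp] theorem coe_weylSp₁_inv_apply (p : F × F) :
    ((weylSp₁⁻¹ : symplecticGroup (polar (LinearMap.mul F F))) : (F × F) ≃ₗ[F] (F × F)) p = (-p.2, p.1) := rfl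

/-- the (upper) unipotent element `u(s) := w · n(-s) · w⁻¹`. [folklore] -/
def upperSp₁ (s : F) : symplecticGroup (polar (LinearMap.mul F F)) :=
  weylSp₁ * unipSp₁ (-s) * weylSp₁⁻¹

/-- action of `u(s) : (x,y) ↦ (x + s y, y)`. [folklore] -/
@[simp] theorem coe_upperSp₁_apply (s : F) (p : F × F) :
    ((upperSp₁ s : symplecticGroup (polar (LinearMap.mul F F))) : (F × F) ≃ₗ[F] (F × F)) p = (p.1 + s * p.2, p.2) := by
  rw [upperSp₁, Subgroup.coe_mul, Subgroup.coe_mul, LinearEquiv.mul_apply, LinearEquiv.mul_apply,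
    coe_weylSp₁_inv_apply, coe_unipSp₁_apply, coe_weylSp₁_apply]
  ext <;> simp only <;> ring

omit [Invertible (2 : F)] in
/-- the matrix entry `a = (g e₁)₁`. [folklore] -/
def entryA (g : symplecticGroup (polar (LinearMap.mul F F))) : F := ((g : (F × F) ≃ₗ[F] (F × F)) (1, 0)).1

omit [Invertible (2 : F)] in
/-- the matrix entry `b = (g e₂)₁`. [folklore] -/
def entryB (g : symplecticGroup (polar (LinearMap.mul F F))) : F := ((g : (F × F) ≃ₗ[F] (F × F)) (0, 1)).1

omit [Invertible (2 : F)] in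
/-- the matrix entry `c = (g e₁)₂`. [folklore] -/
def entryC (g : symplecticGroup (polar (LinearMap.mul F F))) : F := ((g : (F × F) ≃ₗ[F] (F × F)) (1, 0)).2

omit [Invertible (2 : F)] in
/-- the matrix entry `d = (g e₂)₂`. [folklore] -/
def entryD (g : symplecticGroup (polar (LinearMap.mul F F))) : F := ((g : (F × F) ≃ₗ[F] (F × F)) (0, 1)).2

omit [Invertible (2 : F)] in
/-- `g (x,y) = (a x + b y, c x + d y)`. [folklore] -/
theorem apply_eq_entries (g : symplecticGroup (polar (LinearMap.mul F F))) (p : F × F) :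
    (g : (F × F) ≃ₗ[F] (F × F)) p = (entryA g * p.1 + entryB g * p.2, entryC g * p.1 + entryD g * p.2) := by
  have hp : p = p.1 • ((1 : F), (0 : F)) + p.2 • ((0 : F), (1 : F)) := by
    ext <;> simp
  conv_lhs => rw [hp]
  rw [map_add, map_smul, map_smul]
  ext <;> simp only [entryA, entryB, entryC, entryD, Prod.fst_add, Prod.snd_add, Prod.smul_fst, Prod.smul_snd,
    smul_eq_mul] <;> ring

omit [Invertible (2 : F)] in
/-- `a d - b c = 1` (`g` preserves the alternating form `x y' - x' y`). [cite: Weil1964, n° 5, p. 150] -/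
theorem det_entries (g : symplecticGroup (polar (LinearMap.mul F F))) :
    entryA g * entryD g - entryB g * entryC g = 1 := by
  have h := (mem_symplecticGroup (polar (LinearMap.mul F F)) (g : (F × F) ≃ₗ[F] (F × F))).1 g.2 (1, 0) (0, 1)
  simp only [polar_apply, LinearMap.mul_apply', mul_one, mul_zero, sub_zero] at h
  rw [← h]
  rfl

/-! ## §2 Bruhat decomposition and generation in rank one -/

/-- **big cell**: if `c ≠ 0` then `g = u(a/c) · m(-1/c) · w · u(d/c)`. [folklore] -/
theorem eq_bruhat_of_entryC_ne_zero (g : symplecticGroup (polar (LinearMap.mul F F))) (hc : entryC g ≠ 0) :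
    g = upperSp₁ (entryA g / entryC g) * leviSp₁ (Units.mk0 (-(entryC g)⁻¹) (by simp [hc])) * weylSp₁
      * upperSp₁ (entryD g / entryC g) := by
  have hdet := det_entries g
  apply Subtype.ext; apply LinearEquiv.ext; intro p
  rw [apply_eq_entries, Subgroup.coe_mul, Subgroup.coe_mul, Subgroup.coe_mul, LinearEquiv.mul_apply,
    LinearEquiv.mul_apply, LinearEquiv.mul_apply, coe_upperSp₁_apply, coe_weylSp₁_apply, coe_leviSp₁_apply,
    coe_upperSp₁_apply, Units.val_mk0]
  ext
  · simp only
    field_simp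
    linear_combination (-p.2) * hdet
  · simp only
    field_simp

/-- **small cell**: if `c = 0` then `a ∈ Fˣ`, `d = a⁻¹` and `g = m(a) · u(b/a)`. [folklore] -/
theorem eq_borel_of_entryC_eq_zero (g : symplecticGroup (polar (LinearMap.mul F F))) (hc : entryC g = 0)
    (ha : entryA g ≠ 0) : g = leviSp₁ (Units.mk0 (entryA g) ha) * upperSp₁ (entryB g / entryA g) := by
  have hdet := det_entries g
  rw [hc, mul_zero, sub_zero] at hdet
  apply Subtype.ext; apply LinearEquiv.ext; intro p
  rw [apply_eq_entries, Subgroup.coe_mul, LinearEquiv.mul_apply, coe_upperSp₁_apply, coe_leviSp₁_apply,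
    Units.val_mk0, hc]
  ext
  · simp only
    field_simp
  · simp only
    rw [zero_mul, zero_add, eq_comm, inv_mul_eq_iff_eq_mul₀ ha, ← mul_assoc, hdet, one_mul]

omit [Invertible (2 : F)] in
/-- the entry `a` is non-zero on the small cell. [folklore] -/
theorem entryA_ne_zero_of_entryC_eq_zero (g : symplecticGroup (polar (LinearMap.mul F F))) (hc : entryC g = 0) :
    entryA g ≠ 0 := by
  have hdet := det_entries g
  rw [hc, mul_zero, sub_zero] at hdet
  exact left_ne_zero_of_mul_eq_one hdet

/-- the generating set `{m(t)} ∪ {n(s)} ∪ {w}` of `SL₂(F)`. [folklore] -/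
def rankOneGenerators : Set (symplecticGroup (polar (LinearMap.mul F F))) :=
  Set.range leviSp₁ ∪ Set.range unipSp₁ ∪ {weylSp₁}

/-- **`SL₂(F)` is generated by the Levi elements, the lower unipotents and the Weyl element.** [folklore] -/
theorem closure_rankOne_eq_top : Subgroup.closure (rankOneGenerators (F := F)) = ⊤ := by
  rw [eq_top_iff]
  intro g _
  set H := Subgroup.closure (rankOneGenerators (F := F)) with hH
  have hL : ∀ t, leviSp₁ t ∈ H := fun t => Subgroup.subset_closure (Or.inl (Or.inl ⟨t, rfl⟩))
  have hU : ∀ s, unipSp₁ s ∈ H := fun s => Subgroup.subset_closure (Or.inl (Or.inr ⟨s, rfl⟩))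
  have hW : weylSp₁ ∈ H := Subgroup.subset_closure (Or.inr rfl)
  have hV : ∀ s, upperSp₁ s ∈ H := fun s => H.mul_mem (H.mul_mem hW (hU _)) (H.inv_mem hW)
  by_cases hc : entryC g = 0
  · rw [eq_borel_of_entryC_eq_zero g hc (entryA_ne_zero_of_entryC_eq_zero g hc)]
    exact H.mul_mem (hL _) (hV _)
  · rw [eq_bruhat_of_entryC_ne_zero g hc]
    exact H.mul_mem (H.mul_mem (H.mul_mem (hV _) (hL _)) hW) (hV _)

/-- membership form. [folklore] -/
theorem mem_closure_rankOneGenerators (g : symplecticGroup (polar (LinearMap.mul F F))) :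
    g ∈ Subgroup.closure (rankOneGenerators (F := F)) := by
  rw [closure_rankOne_eq_top]; exact Subgroup.mem_top g

end RankOne

/-! ## §3 (R1) in rank one over a non-archimedean local field -/

section LocalField

variable {F : Type*} [Field F] [ValuativeRel F] [TopologicalSpace F] [IsNonarchimedeanLocalField F]
  [Invertible (2 : F)] [MeasurableSpace F] [BorelSpace F] (ψ : AddChar F Circle) (μ : Measure F) [μ.IsAddHaarMeasure]

/-- **(R1) in rank one, KERNEL**: for `ψ` continuous non-trivial and `μ` a self-dual Haar measure, every
`g ∈ Sp(W) = SL₂(F)` admits `M ∈ GL(𝒮(F))` with `M ρ_ψ(h) M⁻¹ = ρ_ψ(g·h)` (MVW Chap. 2 II.1 (A)) in the smooth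
Schrödinger model — by generation (`closure_rankOne_eq_top`) from the Levi / unipotent / Fourier operators.
[cite: MoeglinVignerasWaldspurger1987, Chap. 2 II.1–II.6] -/
theorem existsImplementer_schrodingerSB_rankOne (hψ : ψ.IsContinuousNontrivial) (hμ : IsSelfDualMeasure ψ μ) :
    ExistsImplementer (schrodingerSB (LinearMap.mul F F) ψ (isLocallyConstant_of_isContinuousNontrivial hψ)
      continuous_mul_left_apply) := by
  have hψ' := isLocallyConstant_of_isContinuousNontrivial hψ
  refine existsImplementer_of_closure_eq_top _ rankOneGenerators ?_ closure_rankOne_eq_top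
  rintro g ((⟨t, rfl⟩ | ⟨s, rfl⟩) | hg)
  · refine ⟨leviEquivSB (LinearEquiv.smulOfUnit t) (continuous_const.mul continuous_id)
      (continuous_const.mul continuous_id), ?_⟩
    have h := levi_mem_MpPsi (LinearMap.mul F F) ψ hψ' continuous_mul_left_apply (LinearEquiv.smulOfUnit t)
      (LinearEquiv.smulOfUnit t⁻¹) (mul_smulOfUnit_smulOfUnit_inv t) (continuous_const.mul continuous_id)
      (continuous_const.mul continuous_id)
    rwa [mem_MpPsi] at h
  · refine ⟨unipotentEquivSB ψ hψ' (fun x : F => ⅟(2 : F) * LinearMap.mul F F x (LinearMap.mulLeft F s x))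
      (continuous_const.mul (continuous_id.mul (continuous_const.mul continuous_id))), ?_⟩
    have h := unipotent_mem_MpPsi (LinearMap.mul F F) ψ hψ' continuous_mul_left_apply (LinearMap.mulLeft F s)
      (mul_mulLeft_symm s) (continuous_const.mul (continuous_id.mul (continuous_const.mul continuous_id)))
    rwa [mem_MpPsi] at h
  · rw [Set.mem_singleton_iff] at hg
    subst hg
    refine ⟨tateWeylEquivSB μ hψ hμ, ?_⟩
    rw [weylSp₁, ofSymplectic_weylSp]
    exact tateWeylPair_mem_mpPairs μ hψ hμ

/-- hence `p : S̃p_ψ(W) → Sp(W)` is onto in rank one, KERNEL. [cite: MoeglinVignerasWaldspurger1987, Chap. 2 II.1 (B)] -/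
theorem proj_surjective_schrodingerSB_rankOne (hψ : ψ.IsContinuousNontrivial) (hμ : IsSelfDualMeasure ψ μ) :
    Function.Surjective (MpPsi.proj (schrodingerSB (LinearMap.mul F F) ψ
      (isLocallyConstant_of_isContinuousNontrivial hψ) continuous_mul_left_apply)) :=
  MpPsi.proj_surjective _ (existsImplementer_schrodingerSB_rankOne ψ μ hψ hμ)

end LocalField

end Literature.RepresentationTheory.HeisenbergGroup
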